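import Mathlib
import HarnessLib
import HarnessLib.Audit
import Summits.CriticalPhenomena.Statement
import HarnessLib.Audit.Status.Attr

/-!
Route: SAWDiscreteFlowLine

DORMANT since 2026-08-23T15:51:21Z (reconciler: no traction for 6.1 d (last activity item-evidence-added at 2026-08-17T12:42:33Z); parked, not closed — `ledger route dormant route-CriticalPhenomena-SAWDiscreteFlowLine --off` to reactiva) — unstaffed, not closed; items shared with open routes are served there. `ledger route dormant <id> --off` reactivates.

# Route SAWDiscreteFlowLine — discrete imaginary geometry at kappa = 8/3 — a lattice flow line of
the DGFF as the SAW's pathwise coupling partner; closing by flow-line stability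

It suffices to show X = (L) ∧ (S) ∧ (G) [card discrete-imaginary-geometry-chi: "a winding-tilted
DGFF level-line exploration builds the
SLE(8/3) flow line on the lattice; pathwise coupling partner for the SAW"], all three stated on δℤ²
itself with the zero-Dirichlet
discrete Gaussian free field h⁰_δ living on the FACES of Ω_δ (SRW-normalised covariance = walk sums
on the dual graph; Miller–Sheffield
units through κ₀ = √(π/2)) and the imaginary-geometry constants of κ = 8/3: λ = π√(3/8), λ′ = π/√6,
χ = 1/√6 (MillerSheffield2016 Thm 1.1;
χ² = 1/6 ⟺ c = 0). Conformal geometry of (D; a, b) enters only through a chordal uniformizer φ (∀ φ;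
they differ by dilations, which the
statements do not see): the flow-line DRESSING of a lattice path ξ is the discrete-harmonic function
U^ξ on the slit face-domain with data
0 on ∂ and u(f) = ∓λ′ + χ(α_ℍ − π/2) − λ + (2λ/π) Arg φ⁻¹(centre f) on the faces f first met by ξ
(sign by side; α_ℍ = the ℍ-angle of the
√δ-chord of ξ through f, lifted along the chord sequence) — the lattice shadow of "h given η is a
GFF in D∖η with flow-line boundary
data" (MillerSheffield2016 Thm 1.1), with the branch of arg(φ⁻¹)′ cancelled out. A coupling (ξ, h)
DRESSES WELL if, for every test function
ψ and every prefix ξ[0,k], the conditional characteristic function of κ₀⟨h, ψ⟩_δ given the prefix is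
that of N(⟨U^{ξ[0,k]}, ψ⟩_δ,
(π/2)⟨ψ, G_{slit} ψ⟩_δ) up to o(1) (the progressive form = the hypotheses of IG-I Thm 1.1 at all
lattice times).
 (L) LatticeFlowLine — there is a field-measurable lattice path F_δ(h) from a_δ to b_δ which dresses
h⁰_δ well AND whose law converges to
chordal SLE_{8/3}: "the lattice GFF has a flow line at κ = 8/3" (Miller–Sheffield's discretisation
problem, IG-I p.6, in ∃-form; the
route's named witness is the winding-tilted level-line exploration, crux DiscreteFlowLine, informal
until its definition lands).
 (S) FlowLineStability — two lattice paths coupled to ONE sample of h⁰_δ that both dress it well are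
o(1)-close as curves, in probability
(lattice, quantitative form of flow-line determination, IG-I Thm 1.2).
 (G) GaussianDressing — the critical x_c-SAW γ_δ admits a coupling with an exact DGFF sample which
it dresses well (the coupling form of
the sibling card imaginary-geometry-winding-dirichlet's FlowLineMeanValue; conjunct-strength).
Then (G) ⊗ (L) puts (γ_δ, F_δ(h), h) on one space, (S) forces dist(γ_δ, F_δ(h)) → 0 in probability,
(L) sends F_δ(h) to SLE_{8/3} in law,
and the converging-together lemma gives the conjunct — with NO tightness statement for the SAW
anywhere (it is inherited through the coupling).
Lean: `LatticeFlowLine ∧ FlowLineStability ∧ GaussianDressing`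

## Assembly
Pure logic once the items stand (checked sorry-free in the planner's Sketch.lean: `theorem
assembly_holds : Assembly := fun h1 h2 h3 h4 =>
h4 h1 h2 h3`): PathwiseTransfer is literally the implication (G) → (S) → (L) → conjunct, and all
probability lives inside it and the three
cruxes. No unproved Literature fact is in the import cone (the uniformizer's existence,
MarkedDomain.exists_isChordalUniformizing_holds, is
proved; SLE existence/uniqueness facts are not needed because (L)(i) already delivers an IsSLECurve
Γ).
The one-line terms are written against the gate's route-file header (`open Filter Set Function
TopologicalSpace MeasureTheory`, scoped
`Topology`/`Classical`: `Tendsto`, `𝓝[>] 0`, `Measure`, `if … then … else` on propositions) and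
share a `let` preamble (face-domain
`Fc`, walk-sum Green function `Gf`, exit law `Hm`, side faces `lf/rf`, first adjacency `jf`,
√δ-chords `pt/ang`, data `dat`, dressing `U`,
pairings `pr/Qv`, DGFF characteristic functional `gff`, defect `dfc/dft`), ≤ 4000 characters each;
the definition requests shrink them.

Rationale: WHY THIS LINE. Schramm–Sheffield's DGFF contour-line theorem (SchrammSheffield2009 Thm 1: TG-domain,
boundary data ∓λ, zero contour → SLE₄, general a, b ≥ λ
→ SLE₄(ρ₁;ρ₂); λ = 3^{-1/4}√(π/8) "depends only on the lattice") is, with LERW/UST and the harmonic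
explorer, the integrable-free route from
ℤ²-type lattices to SLE; Miller–Sheffield pose the flow-line analogue as open ("This has not been
proved", MillerSheffield2016 p.6) and
single out κ = 8/3 as the threshold θ_c = πκ/(4−κ) = 2π below which flow lines are self-avoiding
(arXiv:1302.4738 §3.6). The card's move is
to discretise the CHARACTERISING PROPERTY (h ≷ χ·winding across the curve) as an exploration, and to
use the resulting Gaussian-driven
lattice curve not as an observable but as a PATHWISE coupling partner for the SAW: the SAW enters
only through one statement, that it
dresses a free field like a flow line (G), everything else is Gaussian potential theory (L, S) and
the closing is the converging-together
lemma, so the refuted all-δ tightness (stmt-CriticalPhenomena-0772) and every a-priori SAW estimate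
are bypassed. Imported areas: GFF /
imaginary geometry and local-set theory (MillerSheffield2016, SchrammSheffield2010 =
arXiv:1008.2447, Dubedat2009, Werner–Powell
arXiv:2004.04720), discrete potential theory of killed random walks (walk-sum Green functions,
harmonic measure), weak convergence on the
curve space; physically Nienhuis' c = 0 Coulomb gas read constructively (the polymer = the curve
along which a background-charge-χ boson
has a tilted zero level). No prior route of this sub-problem uses a Gaussian field;
SAWHexUniversality / SAWQuantumGravity import a
comparison family from another lattice / from LQG, here the comparison family lives on δℤ² and
carries an exact Markov property in (η, h).

RANKED CRUXES. #0 Target (target) — X = LatticeFlowLine ∧ FlowLineStability ∧ GaussianDressing (§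
Thesis). (why it might fail: (G) is the SAW conjecture's full strength in Gaussian clothing; (L) may
fail if no lattice curve can realise affine-winding flow-line data at χ ≠ 0 (tilted height gap
renormalises anisotropically).) [MillerSheffield2016, SchrammSheffield2009,
LawlerSchrammWerner2004SAW, MillerSheffield2013]
#2 LatticeFlowLine (crux) — (card crux DFL in ∃-form — "the lattice GFF has a κ = 8/3 flow line")
for every Dobrushin domain, endpoint approximation (a_δ, b_δ) and chordal uniformizer φ there is a
family of maps F_δ : (faces → ℝ) → vertex sequences, eventually taking values in the sequences i ↦
ω(i ∧ |ω|) of walks ω of Ω_δ from a_δ to b_δ, such that for every family P_δ of DGFF laws (pinned by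
the characteristic functional: centred Gaussian on the interior faces Fc_δ of Ω_δ with covariance
the killed-walk Green function, zero elsewhere): (i) the curve of F_δ(h) under P_δ converges in law
to chordal SLE_{8/3} in D (ConvergesInLawToSLE, measurability included), and (ii) F_δ dresses the
field well: sup over prefix times k and prefix test functionals |F| ≤ 1 of |E[F(prefix) (e^{i s
κ₀⟨h,ψ⟩_δ} − e^{i s ⟨U^{prefix},ψ⟩_δ − s²(π/2)⟨ψ,G_{slit}ψ⟩_δ/2})]| → 0 for every test function ψ ∈
C_c(D) and s ∈ ℝ. Clause (ii) is what excludes cheating witnesses (a curve sampled from extra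
randomness hidden in h); (i)+(ii) = an asymptotic IG-I coupling realised measurably on the lattice.
[difficulty: open-problem] (why it might fail: At χ≠0 the explored interface sits at a level
jittering by ±χπ/2 per lattice step; the renormalised gap may come out direction-dependent (ℤ²
staircase bias), leaving no isotropic flow-line dressing for ANY lattice witness; only IG-I's ray
numerics support it.) [MillerSheffield2016, SchrammSheffield2009, MillerSheffield2013,
SchrammSheffield2010, KenyonEtAl2016]
#3 FlowLineStability (crux) — (card crux LatticeFlowLineStability, progressive form) for every
Dobrushin domain, endpoint approximation, uniformizer φ and every family of kernels K_δ(ξ¹, ξ²; dh)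
from pairs of vertex sequences to field measures, supported on (frozen vertex sequences of) walks of
Ω_δ from a_δ to b_δ and with total field marginal the face DGFF of Ω_δ: if BOTH paths dress the
field well (the defect of crux 2 (ii) → 0 for each), then for every ε > 0 the K_δ-mass of pairs
whose polylines are at CurveClass-distance ≥ ε tends to 0 as δ → 0⁺. Continuum content: a simple
curve that dresses the GFF like a flow line at all times IS the flow line (uniqueness of the IG-I
coupling, Thm 1.1, plus determination by the field, Thm 1.2; Dubedat2009); lattice content:
stability of that determination under o(1) weak perturbations of the dressing — the quantitative
heart of the pathwise closing. [difficulty: XL] (why it might fail: h ↦ flow line is measurable but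
nowhere continuous; weak (test-function) control of the dressing may be too coarse near pivotal
saddles of the field, where an o(1) defect in H^{-1}-type norms moves the curve macroscopically with
small but non-vanishing probability.) [MillerSheffield2016, Dubedat2009, SchrammSheffield2010,
arXiv:2004.04720, SchrammSheffield2009]
#4 GaussianDressing (crux) — (card crux SAWGaussianDressing, coupling form of
imaginary-geometry-winding-dirichlet's FlowLineMeanValue) for every Dobrushin domain, endpoint
approximation and uniformizer φ there are kernels K_δ(γ; dh), γ ranging over the self-avoiding walks
of Ω_δ from a_δ to b_δ, with first marginal the critical SAW law `SAW.law` (K_δ(γ; univ) = law{γ})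
and field marginal the face DGFF of Ω_δ, under which γ dresses the field well: for every ψ ∈ C_c(D),
s ∈ ℝ, sup over k and |F| ≤ 1 of |Σ_γ ∫ F(γ[0,k]) (e^{i s κ₀⟨h,ψ⟩_δ} − e^{i s⟨U^{γ[0,k]},ψ⟩_δ −
s²(π/2)⟨ψ,G_{Ω_δ∖γ[0,k]}ψ⟩_δ/2}) K_δ(γ; dh)| → 0. In words: averaged over the polymer, the free
field conditioned on any initial piece of the polymer looks exactly as if that piece were a κ = 8/3
flow line — winding enters the Dirichlet DATA with coefficient χ = 1/√6, boundary geometry through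
Arg φ⁻¹ only. [difficulty: open-problem] (why it might fail: It is the conjunct's strength (no
lattice identity makes the SAW a flow line: barrier NienhuisWeightsExcludeVertexSAW); even given SAW
→ SLE(8/3), the √δ-chord winding convention must feed the harmonic extension without bias near the
fractal curve (Beurling-type control of spirals).) [MillerSheffield2016, LawlerSchrammWerner2004SAW,
DuminilCopinSmirnov2012, Dubedat2009,
Literature.Barriers.CriticalPhenomena.NienhuisWeightsExcludeVertexSAW]
#9 PathwiseTransfer (support) — (G) → (S) → (L) → SAWScalingLimit: fix D, (a, b); take φ from
MarkedDomain.exists_isChordalUniformizing_holds (PROVED); compose the SAW kernel of (G) with the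
fibres of F_δ from (L) to get a triple coupling (γ, F_δ(h), h) whose field marginal is the DGFF and
in which both paths dress well (γ by (G), F_δ(h) by (L)(ii)); index γ by its frozen vertex sequence
i ↦ γ.walk.getVert i (injective on SAWs; γ.curve = polyline of that sequence); (S) gives
dist(γ.curve, F_δ(h).curve) → 0 in probability; (L)(i) gives F_δ(h).curve → Γ (SLE_{8/3}) in law;
converging-together (Billingsley Thm 3.1: |∫f∘X − ∫f∘Y| ≤ ε-modulus of f on compacts + 2‖f‖P(dist ≥
ε), with tightness of the CONVERGENT family F_δ(h) only) yields TendstoLaw for γ.curve under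
SAW.law, measurability by SAW.aemeasurable_curve, hence ConvergesInLawToSLE (8/3). Standard measure
theory on top of three syntactically matched statements; no SAW estimate. [difficulty: L]
[Billingsley1999, MillerSheffield2016]

TWO-LAYER PLAN. Foreseen glued splits (filed only after a crux closes or the definitions land; k ≤
3, depth 1):
LatticeFlowLine ⇐ TiltedExplorationConverges → TiltedExplorationDresses → LatticeFlowLine (glue: F
:= the χ-tilted level-line exploration of
crux DiscreteFlowLine; the two children are the two halves of Schramm–Sheffield's scheme — tilted
height gap + martingale identification with
2πχ = (4−κ)λ, and a-priori narrows/obstacle estimates for an interface at a moving level);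
FlowLineStability ⇐ ContinuumFlowLineRigidity (local-set curve with flow-line harmonic part = the
flow line, IG-I Thm 1.1/1.2 as a Literature
fact) → LatticeToContinuumDressing (joint subsequential limits of well-dressing couplings are IG
couplings) → FlowLineStability;
GaussianDressing ⇐ FlowLineMeanValue (sibling card, law form, one point) → DomainMarkovUpgrade
(exact SAW domain Markov + Gaussian closure of
the dressed mixture) → GaussianDressing.

KILL CRITERIA. ¬LatticeFlowLine (no lattice functional of the DGFF dresses it with isotropic
affine-winding data at χ = 1/√6 — e.g. a proof that the
tilted height gap is direction-dependent on ℤ²) closes the route outright (`close --reason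
refuted:LatticeFlowLine`) and retires the card's
DFL; it would not touch the conjunct. ¬FlowLineStability with (L) standing ⇒ pivot to the LAW-level
transfer (TransferShape of route
SAWHexUniversality, stmt-CriticalPhenomena-0802, with Q_δ := law of F_δ(h)) and a new identification
crux — a different, weaker route.
¬GaussianDressing with explicit constants but some other (ℓ′, c) working ⇒ restate with ∃-constants
(the 8/3 content is the ratio
c/λ = 2/(3π)); ¬GaussianDressing for all constants is strong evidence against "SAW = κ = 8/3 flow
line", i.e. against the conjunct's
identification, and closes the route. SAWScalingLimit proved elsewhere moots (G) (it then follows)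
but leaves (L), (S) as GFF theorems.

NOT DECOMPOSED YET. Everything inside DiscreteFlowLine (the tilted height-gap lemma, RSW/narrows
estimates for a moving-level interface, the Loewner/KS
regularity of the explorer, the identification 2πχ = (4−κ)λ ⇒ κ = 8/3); the continuum rigidity fact
behind (S) (to be vendored as a
Literature fact from IG-I Thm 1.1–1.2 before any split); the soft "winding statistic" lemma
(√δ-chord ℍ-angles fed into discrete harmonic
extension converge for curves converging to SLE) shared with the sibling card; the
Skorokhod/Prokhorov bookkeeping inside
PathwiseTransfer; the choice of smoothing scale (any m(δ) → ∞ with m(δ)δ → 0 should do; ⌈δ^{-1/2}⌉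
is fixed in the statements).

CHEAPEST FALSIFIER. Simulation (kit, ~CPU-days, not run in this planning seat): sample the face DGFF
in a 600δ × 300δ lattice rectangle, run the χ-tilted
level-line exploration (definition request TiltedLevelLineExploration: label a newly met face + iff
κ₀h⁰(f) + λ − (2λ/π)Arg φ⁻¹(ctr f) >
χ(α_ℍ(j) − π/2)) for χ ∈ {0, 0.2, 1/√6, 0.6}; estimate κ(χ) from Schramm's left-passage formula and
the driving-function variance, and
REPEAT IN THE RECTANGLE ROTATED BY 30°: (a) κ(0) must be 4 (SS09 control); (b) if κ(1/√6) ≠ 8/3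
beyond error but some χ* gives 8/3, restate
with ∃χ (LatticeFlowLine survives, DiscreteFlowLine's constants change); (c) if the rotated run
disagrees with the axis-parallel run
(anisotropic tilted gap), LatticeFlowLine's named witness is dead and the ∃-form is in serious
doubt; (d) then compare η_δ(χ*) with
pivot-sampled SAWs through left-passage and winding-variance statistics (cheap evidence for or
against GaussianDressing).

NUMBERS. κ = 8/3: λ = π/√κ = π√(3/8) ≈ 1.92382, λ′ = π√κ/4 = π/√6 ≈ 1.28255, χ = 2/√κ − √κ/2 = 1/√6
≈ 0.40825, λ − λ′ = πχ/2 ≈ 0.64127,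
2πχ/λ = 4 − κ = 4/3, θ_c = πκ/(4−κ) = 2π (arXiv:1302.4738 §3.6). Lattice-to-MS scaling on ℤ² faces:
killed SRW Green function
G_δ(z,w) = (2/π)(log 1/|z−w| + harmonic) + o(1) (Lawler–Limic potential kernel a(x) = (2/π)log|x| +
(2γ+log 8)/π), so κ₀ = √(π/2)
multiplies h⁰_δ. Schramm–Sheffield's TG constant λ_TG = 3^{-1/4}√(π/8) ≈ 0.476 (SchrammSheffield2009
Thm 1) = π/2 in MS units — no anomalous
renormalisation at χ = 0. Smoothing block m(δ) = ⌈δ^{-1/2}⌉ steps. Items at open: 6 (target, 3 typed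
cruxes, 1 support, assembly) + 1
informal crux (DiscreteFlowLine, rank 5) filed right after open.

DEFINITION REQUESTS. (D1) `faceDGFF` — Literature/Probability/LatticeModels: the zero-Dirichlet
discrete GFF on the faces of Ω_δ ⊆ δℤ² as a law on
`Site 2 → ℝ` (SRW-normalised covariance = killed-walk Green function on `zdGraph 2`), with the face
Green function / exit distribution
`faceGreen`, `faceHarmonicMeasure`; shrinks the `gff`/`Gf`/`Hm` lets of all three cruxes. (D2)
`TiltedLevelLineExploration` —
Summits/CriticalPhenomena/SAWScalingLimit/Theorems (new object): the χ-tilted level-line exploration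
of κ₀h⁰_δ + 𝔥₀ on the faces of Ω_δ
from a_δ (interface on primal edges keeping label − on its left, + on its right; a face first met at
step j is labelled + iff
κ₀h⁰(f) + λ − (2λ/π)Arg φ⁻¹(ctr f) > χ(α_ℍ(j) − π/2) with α_ℍ the chord-lifted ℍ-angle; saddle
vertices resolved by a fixed turning
rule; labels frozen at first examination) — for crux DiscreteFlowLine. (D3) `flowLineDressing` —
Literature/Probability/RandomPlanarGeometry:
the two-sided IG dressing U^v of a lattice vertex sequence (faces first-adjacent to the path, side
sign, √δ-chord ℍ-angles through a
uniformizer), shared with cards imaginary-geometry-winding-dirichlet and tilted-harmonic-explorer;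
shrinks `K/jf/sg/ang/dat/U`.
(C1) cite fact wanted: IG-I Thm 1.1–1.2 (existence/uniqueness of the flow-line coupling and
determination of the flow line by the field)
as named Literature facts `MillerSheffield2016_thm11`, `_thm12` (continuum GFF needed first —
long-lead item).

Novelty: Searches (2026-08-15): `lit search --source zbmath "imaginary geometry Gaussian free field"` (18: IG
I–IV, BLR dimers+IG arXiv:1603.09740,
GFF light cones, Koshida backward SLE/GFF — no lattice flow-line construction); `"contour lines
discrete Gaussian free field"` (4: SS09, SS13);
`"level lines Gaussian free field general boundary data"` (3: Powell–Wu arXiv:1509.02462,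
Peltola–Wu); `"bipolar orientations planar maps SLE"`
(3: KMSW arXiv:1511.04068) and `"six-vertex model SLE Kenyon Miller Sheffield Wilson"` (1:
arXiv:1605.06471 — lattice height-function paths
read as IG flow lines, numerics); `lit galaxy search "flow lines of the discrete Gaussian free
field" --star all` (0) and `--star pdf --mode
bm25 "discrete flow lines Gaussian free field"` (15: Werner–Powell GFF notes arXiv:2004.04720,
Smirnov ICM, BLR — nothing constructive);
`lit frontier CriticalPhenomena --since 2021` (30 rows, none on GFF flow lines/SAW); `lit vsearch`
(no relevant hit); held texts read:
arXiv:1201.1496 pp.6–8, 22 (flow-line data ∓λ′ + χ·winding, "quarter turn left ⇒ +πχ/2", discretised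
rays "not proved"), arXiv:math/0605337
pp.3–4, 19 (Thm 1, λ_TG, height gap, Narrows lemma); OpenAlex/S2/arXiv APIs rate-limited today
(remote sweep for "discrete flow line" /
"tilted level line" in the Miller–Sheffield–Werner circle OWED to the auditor); the 25 route files
and 142 cards of this sub-problem (no
Gaussian-field construction; siblings imaginary-geometry-winding-dirichlet = identification test,
tilted-ha  [refs: 1603.09740, 1509.02462, 1511.04068, 1605.06471, 2004.04720, 1201.1496, math/0605337, SchrammSheffield2009, MillerSheffield2016, KenyonEtAl2016, BerestyckiLaslierRay2016]

Barriers (technique_class: discrete-imaginary-geometry tilted-level-line pathwise): - technique_class: discrete-imaginary-geometry tilted-level-line pathwise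
- Literature.Barriers.CriticalPhenomena.SAWNotKineticallyGrown: relevant in spirit and evaded
precisely — the witness of (L) IS kinetically grown, but its growth rule is not local in the walk:
it reads an external Gaussian field whose long-range correlations supply the non-locality (exactly
how level lines / the harmonic explorer give κ = 4, not 6); no claim that the explorer has the SAW's
law at finite δ (the barrier's theorem `SAWNotKineticallyGrown_holds`), only pathwise o(1)-closeness
under a coupling.
- Literature.Barriers.CriticalPhenomena.NienhuisWeightsExcludeVertexSAW: applies to any exact local
identity for the uniform ℤ² walk (`not_hasExactVertexRelationZ2`); evaded by design — (G) is an
asymptotic, averaged coupling statement, no vertex relation, no observable identity; honest cost: no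
algebraic engine for (G), which therefore carries conjunct-level difficulty (rank 4, flagged).
- Literature.Barriers.CriticalPhenomena.ParafermionicHalfCauchyRiemann: not met — no parafermionic
observable, no Riemann–Hilbert problem; the only elliptic problems are Dirichlet problems for the
dual-lattice Laplacian, well-posed on every graph.
- Literature.Barriers.CriticalPhenomena.EmbeddingModulusUniqueness: evaded like SS09/LERW —
conformal invariance of lim F_δ(h) comes from the embedded random walk (walk-sum Green functions of
the Euclidean embedding) and from the uniformizer φ fed into the data; nothing is

History (route lifecycle, newest last):
- 2026-08-15T12:42:38Z · rev 1: dropped Target — Target (rank 0) is rendered before the three cruxes it conjoins and therefore stays BLOCKED (missing decls at its position); X = LatticeFlowLine ∧ FlowLineStabi (planner-plancard-CriticalPhenomena-SAWScaling-955c0bc4-0)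
- 2026-08-23T15:51:21Z · DORMANT — reconciler: no traction for 6.1 d (last activity item-evidence-added at 2026-08-17T12:42:33Z); parked, not closed — `ledger route dormant route-CriticalPhenomen (operator:999:308236)

sub-problem: SAWScalingLimit · status: dormant · opened planner-plancard-CriticalPhenomena-SAWScaling-955c0bc4-0 2026-08-15T12:35:46Z · rev 3 · ledger route-CriticalPhenomena-SAWDiscreteFlowLine
GENERATED by the gate from the ledger (D-0016/17). Provers cite these decls: `theorem foo : Summit.CriticalPhenomena.SAWScalingLimit.Theses.SAWDiscreteFlowLine.<Decl> := …` in Summits/CriticalPhenomena/SAWScalingLimit/Theorems/<Name>.lean.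
-/

namespace Summit.CriticalPhenomena.SAWScalingLimit.Theses.SAWDiscreteFlowLine

open scoped BigOperators Topology Manifold Classical MeasureTheory ProbabilityTheory Matrix InnerProductSpace ComplexConjugate ContinuousMap
open Filter Set Function TopologicalSpace MeasureTheory

attribute [summit_statement] _root_.SAWScalingLimit

/-- item stmt-CriticalPhenomena-8240 · crux · rank 2 · open · by planner
why it might fail: Open in print (IG-I p.6 'not been proved'): at χ≠0 the interface sits at a level moving ±πχ/2 per turn against gap λ′; the renormalised tilted gap may be direction-dependent on ℤ² (staircase bias), leaving no isotropic flow-line dressing for ANY lattice witness; only χ=0 (SS09 Thm 1) is known.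
sources: MillerSheffield2016, SchrammSheffield2009, SchrammSheffield2010, MillerSheffield2013, KenyonEtAl2016
[crux] (card crux DFL in ∃-form — "the lattice GFF has a κ = 8/3 flow line") for every Dobrushin
domain, endpoint approximation (a_δ, b_δ) and chordal uniformizer φ there is a family of maps F_δ :
(faces → ℝ) → vertex sequences, eventually taking values in the sequences i ↦ ω(i ∧ |ω|) of walks ω
of Ω_δ from a_δ to b_δ, such that for every family P_δ of DGFF laws (pinned by the characteristic
functional: centred Gaussian on the interior faces Fc_δ of Ω_δ with covariance the killed-walk Green
function, zero elsewhere): (i) the curve of F_δ(h) under P_δ converges in law to chordal SLE_{8/3}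
in D (ConvergesInLawToSLE, measurability included), and (ii) F_δ dresses the field well: sup over
prefix times k and prefix test functionals |F| ≤ 1 of |E[F(prefix) (e^{i s κ₀⟨h,ψ⟩_δ} − e^{i s
⟨U^{prefix},ψ⟩_δ − s²(π/2)⟨ψ,G_{slit}ψ⟩_δ/2})]| → 0 for every test function ψ ∈ C_c(D) and s ∈ ℝ.
Clause (ii) is what excludes cheating witnesses (a curve sampled from extra randomness hidden in h);
(i)+(ii) = an asymptotic IG-I coupling realised measurably on the lattice. [difficulty:
open-problem] -/
@[route_item "route-CriticalPhenomena-SAWDiscreteFlowLine", crux]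
def LatticeFlowLine : Prop :=
  ∀ (D : Literature.Probability.RandomPlanarGeometry.DobrushinDomain) a b, Literature.Probability.RandomPlanarGeometry.SAW.IsEndpointApprox D a b → ∀ φ, D.IsChordalUniformizing φ → let S : Type := Literature.Probability.LatticeModels.Site 2; let pi := Real.pi; let sq := Real.sqrt; let I := Complex.I; let ex := Complex.exp; let ar := Complex.arg; let mp := Literature.Probability.LatticeModels.meshPoint; let Ad := fun δ (x y : S) => (Literature.Probability.LatticeModels.discreteDomainGraph D.carrier δ).Adj x y; let Fc := fun δ => {f : S | Ad δ f (f + ![1,0]) ∧ Ad δ f (f + ![0,1]) ∧ Ad δ (f + ![1,0]) (f + ![1,1]) ∧ Ad δ (f + ![0,1]) (f + ![1,1])}; let ctr := fun δ f => mp δ f + (δ : ℂ) * (1 + I) / 2; let Gf := fun (A : Set S) f g => ∑' ω : (Literature.Probability.LatticeModels.zdGraph 2).Walk f g, if (∀ x ∈ ω.support, x ∈ A) then ((4 : ℝ)⁻¹) ^ ω.length else 0; let Hm := fun A (z f : S) => (Gf A z (f + ![1,0]) + Gf A z (f + ![-1,0]) + Gf A z (f + ![0,1]) + Gf A z (f +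 ![0,-1])) / 4; let lf := fun (x y : S) => if y = x + ![1,0] then x else if y = x + ![0,1] then x + ![-1,0] else if y = x + ![-1,0] then x + ![-1,-1] else x + ![0,-1]; let rf := fun (x y : S) => if y = x + ![1,0] then x + ![0,-1] else if y = x + ![0,1] then x else if y = x + ![-1,0] then x + ![-1,0] else x + ![-1,-1]; let Ed := fun (v : ℕ → S) i f => v (i + 1) ≠ v i ∧ (f = lf (v i) (v (i + 1)) ∨ f = rf (v i) (v (i + 1))); let K := fun v => {f | ∃ i, Ed v i f}; let jf := fun v f => sInf {i | Ed v i f}; let bl := fun (δ : ℝ) => ⌈(sq δ)⁻¹⌉₊; let pt := fun δ (v : ℕ → S) i => φ.symm (mp δ (v (bl δ * i))); let ang := fun δ v B => pi / 2 + ar ((pt δ v 1 - pt δ v 0) / I) + ∑ i ∈ Finset.range B, ar ((pt δ v (i + 2) - pt δ v (i + 1)) / (pt δ v (i + 1) - pt δ v i)); let dat := fun δ v f => (if f = lf (v (jf v f)) (v (jf v f + 1)) then -1 else 1) * (pi / sq 6) + (1 / sq 6) * (ang δ v (jf v f / bl δ) - pi / 2) - pi * sq (3 / 8) + 2 * sq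 (3 / 8) * ar (φ.symm (ctr δ f)); let U := fun δ v z => ∑' f : S, if f ∈ K v then Hm (Fc δ \ K v) z f * dat δ v f else 0; let pr := fun (δ : ℝ) (ψ : ℂ → ℝ) (w : S → ℝ) => ∑' f : S, if f ∈ Fc δ then δ ^ 2 * ψ (ctr δ f) * w f else 0; let Qv := fun (δ : ℝ) (ψ : ℂ → ℝ) (A : Set S) => ∑' f : S, ∑' g : S, if f ∈ Fc δ ∧ g ∈ Fc δ then δ ^ 4 * ψ (ctr δ f) * ψ (ctr δ g) * Gf A f g else 0; let gff := fun (δ : ℝ) (μ : Measure (S → ℝ)) => IsProbabilityMeasure μ ∧ ∀ t : S →₀ ℝ, ∫ h, ex (I * ((∑ f ∈ t.support, t f * h f : ℝ) : ℂ)) ∂μ = ex (-((∑ f ∈ t.support, ∑ g ∈ t.support, t f * t g * Gf (Fc δ) f g : ℝ) : ℂ) / 2); let dfc := fun δ ψ s v h => ex (I * (s * sq (pi / 2) * pr δ ψ h : ℝ)) - ex (I * (s * pr δ ψ (U δ v) : ℝ) - ((s ^ 2 * (pi / 2) * Qv δ ψ (Fc δ \ K v) / 2 : ℝ) : ℂ));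 let dft := fun δ ψ s (ι : Type) (pre : ι → ℕ → ℕ → S) (Kr : ι → Measure (S → ℝ)) => sSup {r : ℝ | ∃ (k : ℕ) (F : (ℕ → S) → ℝ), (∀ v, |F v| ≤ 1) ∧ r = ‖∑' ξ : ι, ∫ h, (F (pre ξ k) : ℂ) * dfc δ ψ s (pre ξ k) h ∂(Kr ξ)‖}; let IsDP := fun δ v => ∃ ω : (Literature.Probability.LatticeModels.discreteDomainGraph D.carrier δ).Walk (a δ) (b δ), v = fun i => ω.getVert i; let len := fun (v : ℕ → S) => sInf {n : ℕ | ∀ i, n ≤ i → v i = v n}; let crv := fun δ v => Literature.Probability.RandomPlanarGeometry.CurveClass.mk ⟨Literature.Probability.LatticeModels.polyline ((List.range (len v + 1)).map (mp δ ∘ v))⟩; ∃ F : ℝ → (S → ℝ) → (ℕ → S), (∀ᶠ δ in (𝓝[>] 0), ∀ h, IsDP δ (F δ h)) ∧ ∀ P : ℝ → Measure (S → ℝ), (∀ᶠ δ in (𝓝[>] 0), gff δ (P δ)) → Literature.Probability.RandomPlanarGeometry.ConvergesInLawToSLE ((8 : NNReal) / 3) D (fun δ h => crv δ (F δ h)) P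 ∧ ∀ (ψ : ℂ → ℝ) s, Continuous ψ → HasCompactSupport ψ → tsupport ψ ⊆ D.carrier → Tendsto (fun δ => dft δ ψ s (ℕ → S) (fun v k i => v (min i k)) (fun v => (P δ).restrict (F δ ⁻¹' {v}))) (𝓝[>] 0) (𝓝 0)

/-- item stmt-CriticalPhenomena-8241 · crux · rank 3 · open · by planner
why it might fail: As typed refuted modulo (L)/(G): IsDP admits non-simple walks; tripling ω++(ω⁻¹++ω)^m keeps dressed faces, jf, defect yet is ε-far in CurveClass (refuter 8241: misstated, repair ω.IsPath). Even repaired: IG-I Thm 1.2 goes by sandwiching, no lattice analogue under weak ψ-control; no tightness.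
sources: MillerSheffield2016, SchrammSheffield2010, Dubedat2009, arXiv:2004.04720, AizenmanBurchard1999
[crux] (card crux LatticeFlowLineStability, progressive form) for every Dobrushin domain, endpoint
approximation, uniformizer φ and every family of kernels K_δ(ξ¹, ξ²; dh) from pairs of vertex
sequences to field measures, supported on (frozen vertex sequences of) walks of Ω_δ from a_δ to b_δ
and with total field marginal the face DGFF of Ω_δ: if BOTH paths dress the field well (the defect
of crux 2 (ii) → 0 for each), then for every ε > 0 the K_δ-mass of pairs whose polylines are at
CurveClass-distance ≥ ε tends to 0 as δ → 0⁺. Continuum content: a simple curve that dresses the GFF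
like a flow line at all times IS the flow line (uniqueness of the IG-I coupling, Thm 1.1, plus
determination by the field, Thm 1.2; Dubedat2009); lattice content: stability of that determination
under o(1) weak perturbations of the dressing — the quantitative heart of the pathwise closing.
[difficulty: XL] -/
@[route_item "route-CriticalPhenomena-SAWDiscreteFlowLine", crux]
def FlowLineStability : Prop :=
  ∀ (D : Literature.Probability.RandomPlanarGeometry.DobrushinDomain) a b, Literature.Probability.RandomPlanarGeometry.SAW.IsEndpointApprox D a b → ∀ φ, D.IsChordalUniformizing φ → let S : Type := Literature.Probability.LatticeModels.Site 2; let pi := Real.pi; let sq := Real.sqrt; let I := Complex.I; let ex := Complex.exp; let ar := Complex.arg; let mp := Literature.Probability.LatticeModels.meshPoint; let Ad := fun δ (x y : S) => (Literature.Probability.LatticeModels.discreteDomainGraph D.carrier δ).Adj x y; let Fc := fun δ => {f : S | Ad δ f (f + ![1,0]) ∧ Ad δ f (f + ![0,1]) ∧ Ad δ (f + ![1,0]) (f + ![1,1]) ∧ Ad δ (f + ![0,1]) (f + ![1,1])}; let ctr := fun δ f => mp δ f + (δ : ℂ) * (1 + I) / 2; let Gf := fun (A : Set S) f g => ∑' ω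 : (Literature.Probability.LatticeModels.zdGraph 2).Walk f g, if (∀ x ∈ ω.support, x ∈ A) then ((4 : ℝ)⁻¹) ^ ω.length else 0; let Hm := fun A (z f : S) => (Gf A z (f + ![1,0]) + Gf A z (f + ![-1,0]) + Gf A z (f + ![0,1]) + Gf A z (f + ![0,-1])) / 4; let lf := fun (x y : S) => if y = x + ![1,0] then x else if y = x + ![0,1] then x + ![-1,0] else if y = x + ![-1,0] then x + ![-1,-1] else x + ![0,-1]; let rf := fun (x y : S) => if y = x + ![1,0] then x + ![0,-1] else if y = x + ![0,1] then x else if y = x + ![-1,0] then x + ![-1,0] else x + ![-1,-1]; let Ed := fun (v : ℕ → S) i f => v (i + 1) ≠ v i ∧ (f = lf (v i) (v (i + 1)) ∨ f = rf (v i) (v (i + 1))); let K := fun v => {f | ∃ i, Ed v i f}; let jf := fun v f => sInf {i | Ed v i f}; let bl := fun (δ : ℝ) => ⌈(sq δ)⁻¹⌉₊; let pt := fun δ (v : ℕ → S) i => φ.symm (mp δ (v (bl δ * i))); let ang := fun δ v B => pi / 2 + ar ((pt δ v 1 - pt δ v 0) / I) + ∑ i ∈ Finset.range B, ar ((pt δ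 v (i + 2) - pt δ v (i + 1)) / (pt δ v (i + 1) - pt δ v i)); let dat := fun δ v f => (if f = lf (v (jf v f)) (v (jf v f + 1)) then -1 else 1) * (pi / sq 6) + (1 / sq 6) * (ang δ v (jf v f / bl δ) - pi / 2) - pi * sq (3 / 8) + 2 * sq (3 / 8) * ar (φ.symm (ctr δ f)); let U := fun δ v z => ∑' f : S, if f ∈ K v then Hm (Fc δ \ K v) z f * dat δ v f else 0; let pr := fun (δ : ℝ) (ψ : ℂ → ℝ) (w : S → ℝ) => ∑' f : S, if f ∈ Fc δ then δ ^ 2 * ψ (ctr δ f) * w f else 0; let Qv := fun (δ : ℝ) (ψ : ℂ → ℝ) (A : Set S) => ∑' f : S, ∑' g : S, if f ∈ Fc δ ∧ g ∈ Fc δ then δ ^ 4 * ψ (ctr δ f) * ψ (ctr δ g) * Gf A f g else 0; let gff := fun (δ : ℝ) (μ : Measure (S → ℝ)) => IsProbabilityMeasure μ ∧ ∀ t : S →₀ ℝ, ∫ h, ex (I * ((∑ f ∈ t.support, t f * h f : ℝ) : ℂ)) ∂μ = ex (-((∑ f ∈ t.support, ∑ g ∈ t.support, t f * t g * Gf (Fc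 δ) f g : ℝ) : ℂ) / 2); let dfc := fun δ ψ s v h => ex (I * (s * sq (pi / 2) * pr δ ψ h : ℝ)) - ex (I * (s * pr δ ψ (U δ v) : ℝ) - ((s ^ 2 * (pi / 2) * Qv δ ψ (Fc δ \ K v) / 2 : ℝ) : ℂ)); let dft := fun δ ψ s (ι : Type) (pre : ι → ℕ → ℕ → S) (Kr : ι → Measure (S → ℝ)) => sSup {r : ℝ | ∃ (k : ℕ) (F : (ℕ → S) → ℝ), (∀ v, |F v| ≤ 1) ∧ r = ‖∑' ξ : ι, ∫ h, (F (pre ξ k) : ℂ) * dfc δ ψ s (pre ξ k) h ∂(Kr ξ)‖}; let IsDP := fun δ v => ∃ ω : (Literature.Probability.LatticeModels.discreteDomainGraph D.carrier δ).Walk (a δ) (b δ), v = fun i => ω.getVert i; let len := fun (v : ℕ → S) => sInf {n : ℕ | ∀ i, n ≤ i → v i = v n}; let crv := fun δ v => Literature.Probability.RandomPlanarGeometry.CurveClass.mk ⟨Literature.Probability.LatticeModels.polyline ((List.range (len v + 1)).map (mp δ ∘ v))⟩; let P2 := (ℕ → S) × (ℕ → S); ∀ Kr : ℝ → (ℕ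 → S) → (ℕ → S) → Measure (S → ℝ), (∀ᶠ δ in (𝓝[>] 0), gff δ (Measure.sum (fun pq : P2 => Kr δ pq.1 pq.2)) ∧ ∀ v₁ v₂, Kr δ v₁ v₂ ≠ 0 → IsDP δ v₁ ∧ IsDP δ v₂) → (∀ (ψ : ℂ → ℝ) s, Continuous ψ → HasCompactSupport ψ → tsupport ψ ⊆ D.carrier → Tendsto (fun δ => dft δ ψ s P2 (fun pq k i => pq.1 (min i k)) (fun pq => Kr δ pq.1 pq.2)) (𝓝[>] 0) (𝓝 0) ∧ Tendsto (fun δ => dft δ ψ s P2 (fun pq k i => pq.2 (min i k)) (fun pq => Kr δ pq.1 pq.2)) (𝓝[>] 0) (𝓝 0)) → ∀ ε : ℝ, 0 < ε → Tendsto (fun δ => ∑' pq : P2, if ε ≤ dist (crv δ pq.1) (crv δ pq.2) then (Kr δ pq.1 pq.2).real univ else 0) (𝓝[>] 0) (𝓝 0)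

/-- item stmt-CriticalPhenomena-8242 · crux · rank 4 · open · by planner
why it might fail: Conjunct-strength: needs SAW→SLE(8/3) progressively coupled to the DGFF; no lattice identity makes the ℤ² SAW a flow line (barrier NienhuisWeightsExcludeVertexSAW; LSW04 = conjecture), law-form test stmt-6979 open; √δ-block winding of a fractal prefix may bias the harmonic data (Beurling control).
sources: LawlerSchrammWerner2004SAW, MillerSheffield2016, MillerSheffield2013, DuminilCopinSmirnov2012, Dubedat2009, Literature.Barriers.CriticalPhenomena.NienhuisWeightsExcludeVertexSAW
[crux] (card crux SAWGaussianDressing, coupling form of imaginary-geometry-winding-dirichlet's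
FlowLineMeanValue) for every Dobrushin domain, endpoint approximation and uniformizer φ there are
kernels K_δ(γ; dh), γ ranging over the self-avoiding walks of Ω_δ from a_δ to b_δ, with first
marginal the critical SAW law `SAW.law` (K_δ(γ; univ) = law{γ}) and field marginal the face DGFF of
Ω_δ, under which γ dresses the field well: for every ψ ∈ C_c(D), s ∈ ℝ, sup over k and |F| ≤ 1 of
|Σ_γ ∫ F(γ[0,k]) (e^{i s κ₀⟨h,ψ⟩_δ} − e^{i s⟨U^{γ[0,k]},ψ⟩_δ − s²(π/2)⟨ψ,G_{Ω_δ∖γ[0,k]}ψ⟩_δ/2})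
K_δ(γ; dh)| → 0. In words: averaged over the polymer, the free field conditioned on any initial
piece of the polymer looks exactly as if that piece were a κ = 8/3 flow line — winding enters the
Dirichlet DATA with coefficient χ = 1/√6, boundary geometry through Arg φ⁻¹ only. [difficulty:
open-problem] -/
@[route_item "route-CriticalPhenomena-SAWDiscreteFlowLine", crux]
def GaussianDressing : Prop :=
  ∀ (D : Literature.Probability.RandomPlanarGeometry.DobrushinDomain) a b, Literature.Probability.RandomPlanarGeometry.SAW.IsEndpointApprox D a b → ∀ φ, D.IsChordalUniformizing φ → let S : Type := Literature.Probability.LatticeModels.Site 2; let pi := Real.pi; let sq := Real.sqrt; let I := Complex.I; let ex := Complex.exp; let ar := Complex.arg; let mp := Literature.Probability.LatticeModels.meshPoint; let Ad := fun δ (x y : S) => (Literature.Probability.LatticeModels.discreteDomainGraph D.carrier δ).Adj x y; let Fc := fun δ => {f : S | Ad δ f (f + ![1,0]) ∧ Ad δ f (f + ![0,1]) ∧ Ad δ (f + ![1,0]) (f + ![1,1]) ∧ Ad δ (f + ![0,1]) (f + ![1,1])}; let ctr := fun δ f => mp δ f + (δ : ℂ) * (1 + I) / 2; let Gf := fun (A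 : Set S) f g => ∑' ω : (Literature.Probability.LatticeModels.zdGraph 2).Walk f g, if (∀ x ∈ ω.support, x ∈ A) then ((4 : ℝ)⁻¹) ^ ω.length else 0; let Hm := fun A (z f : S) => (Gf A z (f + ![1,0]) + Gf A z (f + ![-1,0]) + Gf A z (f + ![0,1]) + Gf A z (f + ![0,-1])) / 4; let lf := fun (x y : S) => if y = x + ![1,0] then x else if y = x + ![0,1] then x + ![-1,0] else if y = x + ![-1,0] then x + ![-1,-1] else x + ![0,-1]; let rf := fun (x y : S) => if y = x + ![1,0] then x + ![0,-1] else if y = x + ![0,1] then x else if y = x + ![-1,0] then x + ![-1,0] else x + ![-1,-1]; let Ed := fun (v : ℕ → S) i f => v (i + 1) ≠ v i ∧ (f = lf (v i) (v (i + 1)) ∨ f = rf (v i) (v (i + 1))); let K := fun v => {f | ∃ i, Ed v i f}; let jf := fun v f => sInf {i | Ed v i f}; let bl := fun (δ : ℝ) => ⌈(sq δ)⁻¹⌉₊; let pt := fun δ (v : ℕ → S) i => φ.symm (mp δ (v (bl δ * i))); let ang := fun δ v B => pi / 2 + ar ((pt δ v 1 - pt δ v 0) / I) + ∑ i ∈ Finset.range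 B, ar ((pt δ v (i + 2) - pt δ v (i + 1)) / (pt δ v (i + 1) - pt δ v i)); let dat := fun δ v f => (if f = lf (v (jf v f)) (v (jf v f + 1)) then -1 else 1) * (pi / sq 6) + (1 / sq 6) * (ang δ v (jf v f / bl δ) - pi / 2) - pi * sq (3 / 8) + 2 * sq (3 / 8) * ar (φ.symm (ctr δ f)); let U := fun δ v z => ∑' f : S, if f ∈ K v then Hm (Fc δ \ K v) z f * dat δ v f else 0; let pr := fun (δ : ℝ) (ψ : ℂ → ℝ) (w : S → ℝ) => ∑' f : S, if f ∈ Fc δ then δ ^ 2 * ψ (ctr δ f) * w f else 0; let Qv := fun (δ : ℝ) (ψ : ℂ → ℝ) (A : Set S) => ∑' f : S, ∑' g : S, if f ∈ Fc δ ∧ g ∈ Fc δ then δ ^ 4 * ψ (ctr δ f) * ψ (ctr δ g) * Gf A f g else 0; let gff := fun (δ : ℝ) (μ : Measure (S → ℝ)) => IsProbabilityMeasure μ ∧ ∀ t : S →₀ ℝ, ∫ h, ex (I * ((∑ f ∈ t.support, t f * h f : ℝ) : ℂ)) ∂μ = ex (-((∑ f ∈ t.support, ∑ g ∈ t.support, t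 f * t g * Gf (Fc δ) f g : ℝ) : ℂ) / 2); let dfc := fun δ ψ s v h => ex (I * (s * sq (pi / 2) * pr δ ψ h : ℝ)) - ex (I * (s * pr δ ψ (U δ v) : ℝ) - ((s ^ 2 * (pi / 2) * Qv δ ψ (Fc δ \ K v) / 2 : ℝ) : ℂ)); let dft := fun δ ψ s (ι : Type) (pre : ι → ℕ → ℕ → S) (Kr : ι → Measure (S → ℝ)) => sSup {r : ℝ | ∃ (k : ℕ) (F : (ℕ → S) → ℝ), (∀ v, |F v| ≤ 1) ∧ r = ‖∑' ξ : ι, ∫ h, (F (pre ξ k) : ℂ) * dfc δ ψ s (pre ξ k) h ∂(Kr ξ)‖}; ∃ Kr : (δ : ℝ) → Literature.Probability.RandomPlanarGeometry.SAW.DomainSAW D.carrier δ (a δ) (b δ) → Measure (S → ℝ), (∀ᶠ δ in (𝓝[>] 0), (∀ γ, Kr δ γ univ = Literature.Probability.RandomPlanarGeometry.SAW.law D.carrier δ (a δ) (b δ) {γ}) ∧ gff δ (Measure.sum (Kr δ))) ∧ ∀ (ψ : ℂ → ℝ) s, Continuous ψ → HasCompactSupport ψ → tsupport ψ ⊆ D.carrier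 → Tendsto (fun δ => dft δ ψ s (Literature.Probability.RandomPlanarGeometry.SAW.DomainSAW D.carrier δ (a δ) (b δ)) (fun γ k i => γ.walk.getVert (min i k)) (Kr δ)) (𝓝[>] 0) (𝓝 0)

-- item stmt-CriticalPhenomena-8333 · support · rank 5 · open · by planner — informal only, no Lean statement yet:
--   [crux] DiscreteFlowLine (card crux DFL, the route's NAMED witness for LatticeFlowLine; informal
--   until defn TiltedLevelLineExploration lands). Setting of the route file: face DGFF h⁰_δ of Ω_δ (zero
--   Dirichlet, SRW-normalised, MS units via κ₀ = √(π/2)), chordal uniformizer φ of (D; a, b), constants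
--   λ = π√(3/8), λ′ = π/√6, χ = 1/√6. The χ-TILTED LEVEL-LINE EXPLORATION η_δ from a_δ: a walk of Ω_δ
--   grown edge by edge; a face f first met at step j is labelled + iff κ₀h⁰_δ(f) + λ − (2λ/π)·Arg
--   φ⁻¹(ctr f) > χ·(α_ℍ(j) − π/2), where α_ℍ(j) is the chord-lifted ℍ-angle of the current
--   ⌈δ^{-1/2}⌉-step block (t

/-- item stmt-CriticalPhenomena-8243 · support · rank 9 · open · by planner
sources: Billingsley1999, MillerSheffield2016
[support] (G) → (S) → (L) → SAWScalingLimit: fix D, (a, b); take φ from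
MarkedDomain.exists_isChordalUniformizing_holds (PROVED); compose the SAW kernel of (G) with the
fibres of F_δ from (L) to get a triple coupling (γ, F_δ(h), h) whose field marginal is the DGFF and
in which both paths dress well (γ by (G), F_δ(h) by (L)(ii)); index γ by its frozen vertex sequence
i ↦ γ.walk.getVert i (injective on SAWs; γ.curve = polyline of that sequence); (S) gives
dist(γ.curve, F_δ(h).curve) → 0 in probability; (L)(i) gives F_δ(h).curve → Γ (SLE_{8/3}) in law;
converging-together (Billingsley Thm 3.1: |∫f∘X − ∫f∘Y| ≤ ε-modulus of f on compacts + 2‖f‖P(dist ≥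
ε), with tightness of the CONVERGENT family F_δ(h) only) yields TendstoLaw for γ.curve under
SAW.law, measurability by SAW.aemeasurable_curve, hence ConvergesInLawToSLE (8/3). Standard measure
theory on top of three syntactically matched statements; no SAW estimate. [difficulty: L] -/
@[route_item "route-CriticalPhenomena-SAWDiscreteFlowLine", crux]
def PathwiseTransfer : Prop :=
  GaussianDressing → FlowLineStability → LatticeFlowLine → SAWScalingLimit

/-- item stmt-CriticalPhenomena-8244 · assembly · rank 1 · open · by planner
sources: Billingsley1999, LawlerSchrammWerner2004SAW
[assembly] GaussianDressing → FlowLineStability → LatticeFlowLine → PathwiseTransfer →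
SAWScalingLimit. -/
@[route_item "route-CriticalPhenomena-SAWDiscreteFlowLine"]
def Assembly : Prop :=
  GaussianDressing → FlowLineStability → LatticeFlowLine → PathwiseTransfer → SAWScalingLimit

/-! D-0027 §2.1 — DECIDING THEOREM (planner-authored via `route open/edit --closes-file`; by planner-rbadge-CriticalPhenomena-SAWDiscreteFl-37535b67-g4-0 2026-08-15T16:11:27Z):
its hypotheses are this route's items and its conclusion the sub-problem Statement (glue_lint), and it elaborates with this file. -/

@[closes "route-CriticalPhenomena-SAWDiscreteFlowLine"] theorem closes : GaussianDressing → FlowLineStability → LatticeFlowLine → PathwiseTransfer → _root_.SAWScalingLimit :=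
  fun hG hS hL hP => hP hG hS hL

end Summit.CriticalPhenomena.SAWScalingLimit.Theses.SAWDiscreteFlowLine
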